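import Summits.CriticalPhenomena.CardyFormulaZ2.Theorems.CardySusyWardWeakHolomorphySpinShiftCrux
import Summits.CriticalPhenomena.CardyFormulaZ2.Theorems.CardySusyWardWeakHolomorphyAliasSplit

/-!
# The crux `CardySusyWard.WeakHolomorphy` is its own formula at the alias spin: `(1/3, ∂̄φ) ↦ (−5/3, ∂φ)`

Line `Sketch` of the crux `CardySusyWard.WeakHolomorphy` (stmt-CriticalPhenomena-11292), lead c3 (infrastructure,
`--supports`).  Composition of `weakHolomorphy_iff_spinShiftVanishes` (the crux is the weak vanishing of the `∂φ`-tested CORNER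
sums of the spin-`−5/3` dart observable) with the every-spin four-dart split `aliasVertex_eq_sum_eventually`
(`2cos(5π/12) · F^{(−5/3)}_δ(z_p) = Σ_k F^{(−5/3)}_δ(c_{p,k})`, `2cos(5π/12) ≠ 0`).  Result (`weakHolomorphy_iff_alias`):

  `WeakHolomorphy  ↔  ∀ D Λ (the same six family hypotheses) ∀ φ ∈ C_c^∞(Ω),`
  `    δ^{5/3} · Σ_z ( ∫ passageSum (medialExploration (Λ δ) ω) δ (−5/3) z dP_{1/2} ) · ∂φ(z_δ) → 0  (δ → 0⁺)`,

i.e. the crux — `δ^{5/3} Σ_z F^{(1/3)}_δ(z) ∂̄φ(z_δ) → 0` for the spin-`1/3` vertex parafermionic observable — is EQUIVALENT to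
the statement obtained from it by replacing the spin `1/3` by its square-lattice alias `1/3 − 2 = −5/3` and `∂̄φ` by `∂φ`,
at the same normalisation.  The spin-`−5/3` vertex observable is, configuration by configuration, the spin-`1/3` one with
every passage re-weighted by the parity sign of its arrival dart (`staggeredKirchhoff_eq_spinShift`); the Coulomb gas assigns it
the two-arm-with-winding dimension `x(−5/3) = 1/4 + 3·(25/9)/4 = 7/3 > 2` (an irrelevant field), the crux asks `o(δ^{1/3})` per
vertex weakly, and the only certified bound on `ℤ²` is the RSW two-arm bound `O(δ^{a₀})` (`Cruxes/WeakHolomorphy/Disproof.lean`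
§D, §F; `STRATEGY-CENSUS.md` §1).  References: Duminil-Copin–Smirnov arXiv:1109.1549 §8.3, Conj. 8.7; Smirnov, Ann. Math. 172
(2010) §2.2.
-/

noncomputable section

namespace Summit.CriticalPhenomena.CardyFormulaZ2.Theorems.WeakHolomorphy.SplitBypass

open scoped BigOperators Topology
open Filter Set MeasureTheory Complex
open _root_.Literature.Probability.LatticeModels
open _root_.Literature.Probability.RandomPlanarGeometry (DobrushinDomain)
open _root_.Literature.Probability.Percolation (BondConfig bondPercolation half)
open _root_.Literature.Barriers.CriticalPhenomena (medialCornersAt medialVertexOf)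
open Summit.CriticalPhenomena.CardyFormulaZ2.Theorems.ParafermionPrecompact.Negative (IsFamily)

/-! ## The alias vertex observable vanishes off the lattice edges -/

/-- A non-zero value of the spin-`σ` vertex observable of the exploration path sits at a genuine lattice edge
`medialVertexOf p` (the passage sum vanishes off the edges of `ℤ²`). [folklore] -/
theorem exists_eq_medialVertexOf_of_passageIntegral_ne_zero {E : DiscreteDobrushin} {δ σ : ℝ} {z : MedialVertex}
    (h : (∫ ω, MedialPath.passageSum (medialExploration E ω) δ σ z ∂(bondPercolation (zdGraph 2) half)) ≠ 0) :
    ∃ p : Site 2 × Fin 2, z = medialVertexOf p := by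
  by_contra hne
  refine h ?_
  have hz : z ∉ (zdGraph 2).edgeSet := fun hz => by
    obtain ⟨x, i, rfl⟩ :=
      Summit.CriticalPhenomena.CardyFormulaZ2.Theorems.ParafermionPrecompact.Negative.exists_eq_mk_add_single hz
    exact hne ⟨(x, i), rfl⟩
  simp [Summit.CriticalPhenomena.CardyFormulaZ2.Theorems.ParafermionPrecompact.Negative.passageSum_medialExploration_eq_zero
    _ _ hz]

/-! ## Corner sums versus the vertex observable, weakly -/

/-- **Weak vanishing of the alias: corner sums ⟺ vertex observable, per family and test function.** Along an admissible family
and for a compactly supported `φ`, `δ^{5/3} Σ_p ∂φ(z_p) Σ_k F^{(−5/3)}_δ(c_{p,k}) → 0` iff `δ^{5/3} Σ_z F^{(−5/3)}_δ(z) ∂φ(z_δ) → 0`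
(`F^{(−5/3)}_δ(z) = ∫ passageSum γ δ (−5/3) z`): eventually the two finsums differ by the factor `2cos(5π/12) ≠ 0`
(`aliasVertex_eq_sum_eventually`). [folklore] -/
theorem spinShift_tendsto_iff_alias (D : DobrushinDomain) (Λ : ℝ → DiscreteDobrushin) (hΛ : IsFamily D Λ) (φ : ℂ → ℂ)
    (hc : HasCompactSupport φ) (hs : tsupport φ ⊆ D.carrier) :
    Tendsto (fun δ : ℝ => ((δ ^ ((5:ℝ) / 3) : ℝ) : ℂ) * ∑ᶠ p : Site 2 × Fin 2,
        (fderiv ℝ φ (medialPoint δ (medialVertexOf p)) 1 -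
            Complex.I * fderiv ℝ φ (medialPoint δ (medialVertexOf p)) Complex.I) / 2 *
          ∑ k : Fin 4, bondDartObservable (Λ δ) δ (-5 / 3) (medialCornersAt p.1 p.2 k))
      (𝓝[>] 0) (𝓝 0) ↔
    Tendsto (fun δ : ℝ => ((δ ^ ((5:ℝ) / 3) : ℝ) : ℂ) * ∑ᶠ z : MedialVertex,
        (∫ ω, MedialPath.passageSum (medialExploration (Λ δ) ω) δ (-5 / 3) z ∂(bondPercolation (zdGraph 2) half)) *
          ((fderiv ℝ φ (medialPoint δ z) 1 - Complex.I * fderiv ℝ φ (medialPoint δ z) Complex.I) / 2))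
      (𝓝[>] 0) (𝓝 0) := by
  classical
  set K := tsupport φ with hKdef
  have hK : IsCompact K := hc.isCompact
  have hKd : ∀ z ∉ K, fderiv ℝ φ z = 0 := fun z hz => fderiv_of_notMem_tsupport ℝ hz
  obtain ⟨CN, hCN⟩ := stub_count K hK
  set c : ℂ := ((2 * Real.cos (((-5 : ℝ) / 3) * Real.pi / 4) : ℝ) : ℂ) with hcdef
  have hc0 : c ≠ 0 := by
    rw [hcdef]; exact_mod_cast two_cos_alias_pos.ne'
  set del : ℂ → ℂ := fun z => (fderiv ℝ φ z 1 - Complex.I * fderiv ℝ φ z Complex.I) / 2 with hdel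
  have hdel0 : ∀ z ∉ K, del z = 0 := fun z hz => by simp [hdel, hKd z hz]
  set X : ℝ → ℂ := fun δ => ((δ ^ ((5:ℝ) / 3) : ℝ) : ℂ) * ∑ᶠ p : Site 2 × Fin 2,
    del (medialPoint δ (medialVertexOf p)) * ∑ k : Fin 4, bondDartObservable (Λ δ) δ (-5 / 3) (medialCornersAt p.1 p.2 k)
    with hX
  set Y : ℝ → ℂ := fun δ => ((δ ^ ((5:ℝ) / 3) : ℝ) : ℂ) * ∑ᶠ z : MedialVertex,
    (∫ ω, MedialPath.passageSum (medialExploration (Λ δ) ω) δ (-5 / 3) z ∂(bondPercolation (zdGraph 2) half)) *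
      del (medialPoint δ z) with hY
  -- ### eventually `X δ = c * Y δ`
  have hXY : ∀ᶠ δ in 𝓝[>] (0:ℝ), X δ = c * Y δ := by
    have E4 : ∀ᶠ δ in 𝓝[>] (0:ℝ), δ ∈ Set.Ioo (0:ℝ) 1 := Ioo_mem_nhdsGT one_pos
    filter_upwards [aliasVertex_eq_sum_eventually D Λ hΛ K hK hs, E4] with δ hdict hδ
    have hδ0 : 0 < δ := hδ.1
    have hδ1 : δ ≤ 1 := hδ.2.le
    obtain ⟨S, hS, -⟩ := hCN δ hδ0 hδ1
    -- the vertex finsum as a sum over `S`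
    set g : MedialVertex → ℂ := fun z =>
      (∫ ω, MedialPath.passageSum (medialExploration (Λ δ) ω) δ (-5 / 3) z ∂(bondPercolation (zdGraph 2) half)) *
        del (medialPoint δ z) with hg
    have hsuppg : Function.support g ⊆ ↑(S.image medialVertexOf) := by
      intro z hz
      rw [Function.mem_support] at hz
      obtain ⟨hF, hψz⟩ := mul_ne_zero_iff.1 hz
      obtain ⟨p, rfl⟩ := exists_eq_medialVertexOf_of_passageIntegral_ne_zero hF
      have hzK : medialPoint δ (medialVertexOf p) ∈ K := by
        by_contra h
        exact hψz (hdel0 _ h)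
      simp only [Finset.coe_image, Set.mem_image, Finset.mem_coe]
      exact ⟨p, hS p (Metric.self_subset_cthickening _ hzK), rfl⟩
    have hYsum : ∑ᶠ z : MedialVertex, g z = ∑ p ∈ S, g (medialVertexOf p) := by
      rw [finsum_eq_sum_of_support_subset g hsuppg, Finset.sum_image fun p _ q _ h => medialVertexOf_injective h]
    -- the corner finsum as a sum over `S`
    set f : Site 2 × Fin 2 → ℂ := fun p =>
      del (medialPoint δ (medialVertexOf p)) * ∑ k : Fin 4, bondDartObservable (Λ δ) δ (-5 / 3) (medialCornersAt p.1 p.2 k)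
      with hf
    have hXsum : ∑ᶠ p : Site 2 × Fin 2, f p = ∑ p ∈ S, f p := by
      refine finsum_eq_sum_of_support_subset _ fun p hp => ?_
      rw [Function.mem_support] at hp
      have hzK : medialPoint δ (medialVertexOf p) ∈ K := by
        by_contra hz
        exact hp (by rw [hf]; simp only [hdel0 _ hz, zero_mul])
      exact hS p (Metric.self_subset_cthickening K hzK)
    -- termwise: `f p = c * g (z_p)`
    have hterm : ∀ p ∈ S, f p = c * g (medialVertexOf p) := by
      intro p _
      by_cases hzK : medialPoint δ (medialVertexOf p) ∈ K
      · rw [hf, hg]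
        dsimp only
        rw [← hdict p hzK]
        ring
      · rw [hf, hg]
        dsimp only
        rw [hdel0 _ hzK]
        ring
    show ((δ ^ ((5:ℝ) / 3) : ℝ) : ℂ) * ∑ᶠ p : Site 2 × Fin 2, f p = c * (((δ ^ ((5:ℝ) / 3) : ℝ) : ℂ) * ∑ᶠ z : MedialVertex, g z)
    rw [hXsum, hYsum, Finset.sum_congr rfl hterm, ← Finset.mul_sum]
    ring
  -- ### the equivalence
  change Tendsto X (𝓝[>] 0) (𝓝 0) ↔ Tendsto Y (𝓝[>] 0) (𝓝 0)
  constructor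
  · intro hXt
    have h := (hXt.congr' hXY).const_mul c⁻¹
    simp only [mul_zero] at h
    refine h.congr' (Eventually.of_forall fun δ => ?_)
    rw [← mul_assoc, inv_mul_cancel₀ hc0, one_mul]
  · intro hYt
    have h := hYt.const_mul c
    simp only [mul_zero] at h
    exact h.congr' (hXY.mono fun δ hδ => hδ.symm)

/-- **The crux is its own formula at the alias spin.** `WeakHolomorphy` — `δ^{5/3} Σ_z F^{(1/3)}_δ(z) ∂̄φ(z_δ) → 0` along every
admissible square-lattice discretisation family of every Dobrushin domain, for every test function — holds if and only if the
SAME statement holds with the spin `1/3` replaced by its square-lattice alias `−5/3` and `∂̄φ = (∂_xφ + i∂_yφ)/2` replaced by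
`∂φ = (∂_xφ − i∂_yφ)/2`. [cite: DuminilCopinSmirnov2012Lattice, Conjecture 8.7] -/
theorem weakHolomorphy_iff_alias :
    Summit.CriticalPhenomena.CardyFormulaZ2.Theses.CardySusyWard.WeakHolomorphy ↔
    ∀ (D : DobrushinDomain) (Λ : ℝ → DiscreteDobrushin), (∀ δ, (Λ δ).Ω = D.carrier) → (∀ δ, (Λ δ).δ = δ) →
      Tendsto (fun δ : ℝ => Metric.hausdorffEDist (Λ δ).arcA (D.arc 0)) (𝓝[>] 0) (𝓝 0) →
      Tendsto (fun δ : ℝ => Metric.hausdorffEDist (Λ δ).arcB (D.arc 1)) (𝓝[>] 0) (𝓝 0) →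
      Tendsto (fun δ : ℝ => Metric.hausdorffEDist (medialPoint δ '' (Λ δ).zdABEdges) {D.pt 0, D.pt 1}) (𝓝[>] 0) (𝓝 0) →
      (∀ᶠ δ in 𝓝[>] (0:ℝ), (Λ δ).IsZdAdmissible) →
      ∀ (φ : ℂ → ℂ), ContDiff ℝ (⊤ : ℕ∞) φ → HasCompactSupport φ → tsupport φ ⊆ D.carrier →
        Tendsto (fun δ : ℝ => ((δ ^ ((5:ℝ) / 3) : ℝ) : ℂ) * ∑ᶠ z : MedialVertex,
            (∫ ω, MedialPath.passageSum (medialExploration (Λ δ) ω) δ (-5 / 3) z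
                ∂(bondPercolation (zdGraph 2) half)) *
              ((fderiv ℝ φ (medialPoint δ z) 1 - Complex.I * fderiv ℝ φ (medialPoint δ z) Complex.I) / 2))
          (𝓝[>] 0) (𝓝 0) := by
  rw [weakHolomorphy_iff_spinShiftVanishes]
  constructor
  · intro h D Λ h1 h2 h3 h4 h5 h6 φ hφ hc hs
    exact (spinShift_tendsto_iff_alias D Λ ⟨h1, h2, h3, h4, h5, h6⟩ φ hc hs).1 (h D Λ ⟨h1, h2, h3, h4, h5, h6⟩ φ hφ hc hs)
  · intro h D Λ hΛ φ hφ hc hs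
    obtain ⟨h1, h2, h3, h4, h5, h6⟩ := hΛ
    exact (spinShift_tendsto_iff_alias D Λ ⟨h1, h2, h3, h4, h5, h6⟩ φ hc hs).2 (h D Λ h1 h2 h3 h4 h5 h6 φ hφ hc hs)

/-- **Registered one-line form of `weakHolomorphy_iff_alias`**: the crux is EQUIVALENT to its own formula with the spin `1/3`
replaced by the square-lattice alias `−5/3` and `∂̄φ` replaced by `∂φ`. [cite: DuminilCopinSmirnov2012Lattice, Conjecture 8.7] -/
theorem stub_weakHolomorphyIffAlias : Summit.CriticalPhenomena.CardyFormulaZ2.Theses.CardySusyWard.WeakHolomorphy ↔ ∀ (D : DobrushinDomain) (Λ : ℝ → DiscreteDobrushin), (∀ δ, (Λ δ).Ω = D.carrier) → (∀ δ, (Λ δ).δ = δ) → Tendsto (fun δ : ℝ => Metric.hausdorffEDist (Λ δ).arcA (D.arc 0)) (𝓝[>] 0) (𝓝 0) → Tendsto (fun δ : ℝ => Metric.hausdorffEDist (Λ δ).arcB (D.arc 1)) (𝓝[>] 0) (𝓝 0) → Tendsto (fun δ : ℝ => Metric.hausdorffEDist (medialPoint δ '' (Λ δ).zdABEdges) {D.pt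 0, D.pt 1}) (𝓝[>] 0) (𝓝 0) → (∀ᶠ δ in 𝓝[>] (0:ℝ), (Λ δ).IsZdAdmissible) → ∀ (φ : ℂ → ℂ), ContDiff ℝ (⊤ : ℕ∞) φ → HasCompactSupport φ → tsupport φ ⊆ D.carrier → Tendsto (fun δ : ℝ => ((δ ^ ((5:ℝ) / 3) : ℝ) : ℂ) * ∑ᶠ z : MedialVertex, (∫ ω, MedialPath.passageSum (medialExploration (Λ δ) ω) δ (-5 / 3) z ∂(bondPercolation (zdGraph 2) half)) * ((fderiv ℝ φ (medialPoint δ z) 1 - Complex.I * fderiv ℝ φ (medialPoint δ z) Complex.I) / 2)) (𝓝[>] 0) (𝓝 0) :=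
  weakHolomorphy_iff_alias

end Summit.CriticalPhenomena.CardyFormulaZ2.Theorems.WeakHolomorphy.SplitBypass

end
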